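import Literature.NumberTheory.Sieve.LargeSieveCharacters
import HarnessLib

/-!
# Double Abel summation and the frequency sum of Proposition 7.1 (Tao–Teräväinen 2022, §7)

Topic `Literature/Barriers/Parity`, sub-namespace `TaoTeravainen`; a tool file of the proof DAG of
`Literature.Barriers.Parity.TaoTeravainen2021_prop72_81_pair` (T. Tao, J. Teräväinen, *The
Hardy–Littlewood–Chowla conjecture in the presence of a Siegel zero*, J. London Math. Soc. (2) 106
(2022), arXiv:2109.06291), proof of Proposition 7.1 (i), the estimate of the quantity `Y`:
"From repeated summation by parts we have
`∑_{n₁,n₂} Φ̃_t(n₂) ψ_I(n₁n₂) e_q(u₁n₁ + u₂n₂) ≪ x^{O(ε)} / (‖u₁/q‖ ‖u₂/q‖)` … Writing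
`u₁ = d u'₁`, `u₂ = d u'₂` … `Y ≪ x^{O(ε)} ∑_{d ∣ q} d^{1/2} ((q/d) log(2 + q/d))² ≪ x^{O(ε)} q²`."
Everything here is PROVED, in the following explicit forms:

* `norm_sum_mul_pow_le` — **Abel summation**: for `G : ℕ → ℂ` with `G 0 = 0` and `G n = 0`
  for `n > N`, and `|z| = 1`, `z ≠ 1`,
  `|∑_{n ≤ N} G(n) zⁿ| ≤ (2/|z - 1|) ∑_{1 ≤ j ≤ N} |G(j) - G(j-1)|`;
* `norm_sum_sum_mul_pow_pow_le` — **double Abel summation**: for `G : ℕ → ℕ → ℂ` vanishing when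
  `n₁ = 0`, `n₂ = 0`, `n₁ > N₁` or `n₂ > N₂`,
  `|∑_{n₁ ≤ N₁} ∑_{n₂ ≤ N₂} G(n₁,n₂) z₁^{n₁} z₂^{n₂}| ≤ 4/(|z₁-1| |z₂-1|) ∑_{j₁,j₂ ≥ 1} |Δ₁Δ₂G(j₁,j₂)|`
  with the mixed difference `Δ₁Δ₂G(j₁,j₂) = G(j₁,j₂) - G(j₁-1,j₂) - G(j₁,j₂-1) + G(j₁-1,j₂-1)`;
* `sum_gcd_div_le` — `∑_{0<b<Q} (b,Q)/b ≤ τ(Q)(1 + log Q)`, and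
  `sum_gcd_mul_inv_norm_le` — `∑_{0<b<Q} (b,Q)/|e(b/Q)-1| ≤ (Q/2) τ(Q) (1 + log Q)` (the tree's
  harmonic majorant `inv_norm_e_sub_one_le` of `Literature/NumberTheory/Sieve/LargeSieveCharacters.lean`
  with the weight `(b,Q)`);
* `sum_sqrt_gcd_div_le` — the frequency sum of the `Y`-bound:
  `∑_{u₁,u₂ ∈ ℤ/Qℤ ∖ {0}} (u₁,u₂,Q)^{1/2}/(|e(u₁/Q)-1| |e(u₂/Q)-1|) ≤ (Q²/4) τ(Q)² (1 + log Q)²`.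
  [cite: TaoTeravainen2021, proof of Proposition 7.1 (the bound for Y)]
-/

noncomputable section

open Finset Real Complex
open Literature.NumberTheory.Sieve.LargeSieve (e e_add e_nat_mul norm_e norm_e_sub_one
  norm_geom_sum_le inv_norm_e_sub_one_le sum_Ioo_div_add_div_le e_div_eq_stdAddChar)

namespace Literature.Barriers.Parity

namespace TaoTeravainen

/-! ### Abel summation in one variable -/

/-- A geometric progression over `j ≤ n ≤ N`: `|∑_{n=j}^{N} zⁿ| ≤ 2/|z-1|` for `|z| = 1 ≠ z`.
[folklore] -/
theorem norm_sum_Icc_pow_le {z : ℂ} (hz : ‖z‖ = 1) (hz1 : z ≠ 1) (j N : ℕ) :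
    ‖∑ n ∈ Icc j N, z ^ n‖ ≤ 2 / ‖z - 1‖ := by
  rcases le_or_gt j N with hjN | hjN
  · have h : ∑ n ∈ Icc j N, z ^ n = z ^ j * ∑ k ∈ range (N + 1 - j), z ^ k := by
      rw [mul_sum, ← Finset.Ico_add_one_right_eq_Icc, Finset.sum_Ico_eq_sum_range]
      refine sum_congr rfl fun k _ => ?_
      rw [← pow_add]
    rw [h, norm_mul, norm_pow, hz, one_pow, one_mul]
    exact norm_geom_sum_le hz hz1 _
  · rw [Finset.Icc_eq_empty_of_lt hjN, sum_empty, norm_zero]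
    positivity

/-- **Abel summation (summation by parts) for a finitely supported sequence**: if `G 0 = 0`,
`G n = 0` for `n > N`, `|z| = 1` and `z ≠ 1`, then
`|∑_{n ≤ N} G(n) zⁿ| ≤ (2/|z-1|) ∑_{1 ≤ j ≤ N} |G(j) - G(j-1)|`
(write `G(n) = ∑_{j ≤ n} (G(j) - G(j-1))` and exchange the sums).
[cite: TaoTeravainen2021, proof of Proposition 7.1 ("repeated summation by parts")] -/
theorem norm_sum_mul_pow_le (G : ℕ → ℂ) (hG0 : G 0 = 0) {z : ℂ} (hz : ‖z‖ = 1) (hz1 : z ≠ 1)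
    (N : ℕ) :
    ‖∑ n ∈ range (N + 1), G n * z ^ n‖ ≤
      2 / ‖z - 1‖ * ∑ j ∈ Icc 1 N, ‖G j - G (j - 1)‖ := by
  -- telescoping
  have htel : ∀ n : ℕ, G n = ∑ j ∈ Icc 1 n, (G j - G (j - 1)) := by
    intro n
    have h := Finset.sum_range_sub (fun j => G j) n
    rw [hG0, sub_zero] at h
    rw [← h, ← Finset.Ico_add_one_right_eq_Icc, Finset.sum_Ico_eq_sum_range,
      show n + 1 - 1 = n from rfl]
    refine sum_congr rfl fun j _ => ?_
    rw [show 1 + j - 1 = j by omega, add_comm]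
  -- exchange the sums: `∑_{n ≤ N} zⁿ ∑_{1 ≤ j ≤ n} D j = ∑_{1 ≤ j ≤ N} D j ∑_{j ≤ n ≤ N} zⁿ`
  have hswap : ∑ n ∈ range (N + 1), G n * z ^ n =
      ∑ j ∈ Icc 1 N, (G j - G (j - 1)) * ∑ n ∈ Icc j N, z ^ n := by
    calc ∑ n ∈ range (N + 1), G n * z ^ n
        = ∑ n ∈ range (N + 1), ∑ j ∈ Icc 1 N,
            (if j ≤ n then (G j - G (j - 1)) * z ^ n else 0) := by
          refine sum_congr rfl fun n hn => ?_
          rw [mem_range] at hn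
          rw [htel n, sum_mul, ← sum_filter]
          congr 1
          ext j
          simp only [mem_Icc, mem_filter]
          omega
      _ = ∑ j ∈ Icc 1 N, ∑ n ∈ range (N + 1),
            (if j ≤ n then (G j - G (j - 1)) * z ^ n else 0) := sum_comm
      _ = ∑ j ∈ Icc 1 N, (G j - G (j - 1)) * ∑ n ∈ Icc j N, z ^ n := by
          refine sum_congr rfl fun j hj => ?_
          rw [mem_Icc] at hj
          rw [mul_sum, ← sum_filter]
          congr 1
          ext n
          simp only [mem_range, mem_filter, mem_Icc]
          omega
  rw [hswap, mul_sum]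
  refine (norm_sum_le _ _).trans (sum_le_sum fun j _ => ?_)
  rw [norm_mul, div_mul_eq_mul_div, le_div_iff₀ (norm_pos_iff.mpr (sub_ne_zero.mpr hz1))]
  have h := norm_sum_Icc_pow_le hz hz1 j N
  rw [le_div_iff₀ (norm_pos_iff.mpr (sub_ne_zero.mpr hz1))] at h
  calc ‖G j - G (j - 1)‖ * ‖∑ n ∈ Icc j N, z ^ n‖ * ‖z - 1‖
      = ‖G j - G (j - 1)‖ * (‖∑ n ∈ Icc j N, z ^ n‖ * ‖z - 1‖) := by ring
    _ ≤ ‖G j - G (j - 1)‖ * 2 := by gcongr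
    _ = 2 * ‖G j - G (j - 1)‖ := mul_comm _ _

/-! ### Abel summation in two variables -/

/-- The mixed second difference `Δ₁Δ₂G(j₁,j₂) = G(j₁,j₂) - G(j₁-1,j₂) - G(j₁,j₂-1) + G(j₁-1,j₂-1)`.
[folklore] -/
def mixedDiff (G : ℕ → ℕ → ℂ) (j₁ j₂ : ℕ) : ℂ :=
  G j₁ j₂ - G (j₁ - 1) j₂ - G j₁ (j₂ - 1) + G (j₁ - 1) (j₂ - 1)

/-- **Double Abel summation**: for `G : ℕ → ℕ → ℂ` with `G(0,·) = G(·,0) = 0` and `|zᵢ| = 1`,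
`zᵢ ≠ 1` (only the values `G(n₁,n₂)`, `nᵢ ≤ Nᵢ`, enter),
`|∑_{n₁ ≤ N₁} ∑_{n₂ ≤ N₂} G(n₁,n₂) z₁^{n₁} z₂^{n₂}| ≤ 4/(|z₁-1||z₂-1|) ∑_{1≤j₁≤N₁} ∑_{1≤j₂≤N₂} |Δ₁Δ₂G(j₁,j₂)|`
("from repeated summation by parts"). [cite: TaoTeravainen2021, proof of Proposition 7.1] -/
theorem norm_sum_sum_mul_pow_pow_le (G : ℕ → ℕ → ℂ) (N₁ N₂ : ℕ)
    (hG₁ : ∀ n₂, G 0 n₂ = 0) (hG₂ : ∀ n₁, G n₁ 0 = 0)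
    {z₁ z₂ : ℂ} (hz₁ : ‖z₁‖ = 1) (hz₁1 : z₁ ≠ 1) (hz₂ : ‖z₂‖ = 1) (hz₂1 : z₂ ≠ 1) :
    ‖∑ n₁ ∈ range (N₁ + 1), ∑ n₂ ∈ range (N₂ + 1), G n₁ n₂ * z₁ ^ n₁ * z₂ ^ n₂‖ ≤
      4 / (‖z₁ - 1‖ * ‖z₂ - 1‖) * ∑ j₁ ∈ Icc 1 N₁, ∑ j₂ ∈ Icc 1 N₂, ‖mixedDiff G j₁ j₂‖ := by
  -- the inner sums `H(n₁) = ∑_{n₂} G(n₁,n₂) z₂^{n₂}`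
  set H : ℕ → ℂ := fun n₁ => ∑ n₂ ∈ range (N₂ + 1), G n₁ n₂ * z₂ ^ n₂ with hH
  have hH0 : H 0 = 0 := by
    simp only [hH, hG₁, zero_mul, sum_const_zero]
  have hstep1 : ∑ n₁ ∈ range (N₁ + 1), ∑ n₂ ∈ range (N₂ + 1), G n₁ n₂ * z₁ ^ n₁ * z₂ ^ n₂ =
      ∑ n₁ ∈ range (N₁ + 1), H n₁ * z₁ ^ n₁ := by
    refine sum_congr rfl fun n₁ _ => ?_
    rw [hH, sum_mul]
    refine sum_congr rfl fun n₂ _ => ?_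
    ring
  rw [hstep1]
  have h1 := norm_sum_mul_pow_le H hH0 hz₁ hz₁1 N₁
  refine h1.trans ?_
  -- `H(j) - H(j-1) = ∑_{n₂} (G(j,n₂) - G(j-1,n₂)) z₂^{n₂}`, Abel again in `n₂`
  have h2 : ∀ j₁ ∈ Icc 1 N₁, ‖H j₁ - H (j₁ - 1)‖ ≤
      2 / ‖z₂ - 1‖ * ∑ j₂ ∈ Icc 1 N₂, ‖mixedDiff G j₁ j₂‖ := by
    intro j₁ _
    have hdiff : H j₁ - H (j₁ - 1) =
        ∑ n₂ ∈ range (N₂ + 1), (G j₁ n₂ - G (j₁ - 1) n₂) * z₂ ^ n₂ := by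
      simp only [hH, ← sum_sub_distrib]
      refine sum_congr rfl fun n₂ _ => ?_
      ring
    rw [hdiff]
    have h3 := norm_sum_mul_pow_le (fun n₂ => G j₁ n₂ - G (j₁ - 1) n₂)
      (by simp only [hG₂, sub_self]) hz₂ hz₂1 N₂
    refine h3.trans (le_of_eq ?_)
    congr 1
    refine sum_congr rfl fun j₂ _ => ?_
    unfold mixedDiff
    congr 1
    ring
  have hz : 0 < ‖z₁ - 1‖ := norm_pos_iff.mpr (sub_ne_zero.mpr hz₁1)
  have hz' : 0 < ‖z₂ - 1‖ := norm_pos_iff.mpr (sub_ne_zero.mpr hz₂1)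
  calc 2 / ‖z₁ - 1‖ * ∑ j ∈ Icc 1 N₁, ‖H j - H (j - 1)‖
      ≤ 2 / ‖z₁ - 1‖ * ∑ j₁ ∈ Icc 1 N₁, (2 / ‖z₂ - 1‖ * ∑ j₂ ∈ Icc 1 N₂, ‖mixedDiff G j₁ j₂‖) := by
        gcongr with j₁ hj₁
        exact h2 j₁ hj₁
    _ = 4 / (‖z₁ - 1‖ * ‖z₂ - 1‖) * ∑ j₁ ∈ Icc 1 N₁, ∑ j₂ ∈ Icc 1 N₂, ‖mixedDiff G j₁ j₂‖ := by
        rw [← mul_sum]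
        field_simp
        ring

/-! ### The frequency sum `∑ (u₁,u₂,Q)^{1/2}/(‖u₁/Q‖ ‖u₂/Q‖)` -/

/-- `∑_{0<b<Q} (b,Q)/b ≤ τ(Q)(1 + log Q)`: bound `(b,Q) ≤ ∑_{d ∣ (b,Q)} d` and exchange, each
`d ∣ Q` contributing a harmonic sum. [folklore] -/
theorem sum_gcd_div_le (Q : ℕ) :
    ∑ b ∈ Ioo 0 Q, ((Nat.gcd b Q : ℕ) : ℝ) / b ≤ (Nat.divisors Q).card * (1 + Real.log Q) := by
  rcases Nat.eq_zero_or_pos Q with rfl | hQ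
  · simp
  have hgcd : ∀ b ∈ Ioo 0 Q, ((Nat.gcd b Q : ℕ) : ℝ) / b ≤
      ∑ d ∈ Nat.divisors Q, if d ∣ b then (d : ℝ) / b else 0 := by
    intro b hb
    rw [mem_Ioo] at hb
    have hb0 : (0 : ℝ) < b := by exact_mod_cast hb.1
    rw [← sum_filter, ← sum_div]
    gcongr
    -- `(b,Q) ≤ ∑_{d ∣ Q, d ∣ b} d` since `(b,Q)` is one of the terms
    have hmem : Nat.gcd b Q ∈ (Nat.divisors Q).filter (fun d => d ∣ b) := by
      rw [mem_filter, Nat.mem_divisors]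
      exact ⟨⟨Nat.gcd_dvd_right _ _, hQ.ne'⟩, Nat.gcd_dvd_left _ _⟩
    have := Finset.single_le_sum (f := fun d : ℕ => (d : ℝ)) (fun d _ => Nat.cast_nonneg d) hmem
    exact_mod_cast this
  refine (sum_le_sum hgcd).trans ?_
  rw [sum_comm]
  have hharm : ∀ d ∈ Nat.divisors Q, ∑ b ∈ Ioo 0 Q, (if d ∣ b then (d : ℝ) / b else 0) ≤
      1 + Real.log Q := by
    intro d hd
    rw [Nat.mem_divisors] at hd
    have hd0 : 0 < d := Nat.pos_of_dvd_of_pos hd.1 hQ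
    have hd0' : (0 : ℝ) < d := by exact_mod_cast hd0
    -- the multiples of `d` in `(0, Q)` are `d k` with `1 ≤ k ≤ Q`
    rw [← sum_filter]
    have hinj : Set.InjOn (fun b : ℕ => b / d) ((Ioo 0 Q).filter (fun b => d ∣ b) : Set ℕ) := by
      intro b hb b' hb' h
      rw [Finset.coe_filter, Set.mem_setOf_eq] at hb hb'
      exact (Nat.div_left_inj hb.2 hb'.2).mp h
    calc ∑ b ∈ (Ioo 0 Q).filter (fun b => d ∣ b), (d : ℝ) / b
        = ∑ b ∈ (Ioo 0 Q).filter (fun b => d ∣ b), (((b / d : ℕ) : ℝ))⁻¹ := by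
          refine sum_congr rfl fun b hb => ?_
          rw [mem_filter] at hb
          obtain ⟨k, rfl⟩ := hb.2
          rw [Nat.mul_div_cancel_left _ hd0, Nat.cast_mul]
          have hk : (0 : ℝ) < k := by
            rcases Nat.eq_zero_or_pos k with rfl | hk
            · simp [mem_Ioo] at hb
            · exact_mod_cast hk
          field_simp
      _ = ∑ k ∈ ((Ioo 0 Q).filter (fun b => d ∣ b)).image (fun b => b / d), ((k : ℝ))⁻¹ := by
          rw [Finset.sum_image hinj]
      _ ≤ ∑ k ∈ Icc 1 Q, ((k : ℝ))⁻¹ := by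
          refine sum_le_sum_of_subset_of_nonneg ?_ fun k _ _ => by positivity
          intro k hk
          rw [mem_image] at hk
          obtain ⟨b, hb, rfl⟩ := hk
          rw [mem_filter, mem_Ioo] at hb
          obtain ⟨⟨hb0, hbQ⟩, hdb⟩ := hb
          rw [mem_Icc]
          constructor
          · exact Nat.div_pos (Nat.le_of_dvd hb0 hdb) hd0
          · exact (Nat.div_le_self _ _).trans hbQ.le
      _ ≤ 1 + Real.log Q := by
          have h2 : ∑ b ∈ Icc 1 Q, ((b : ℝ))⁻¹ = harmonic Q := by
            rw [harmonic_eq_sum_Icc]; push_cast; rfl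
          rw [h2]
          exact_mod_cast harmonic_le_one_add_log Q
  calc ∑ d ∈ Nat.divisors Q, ∑ b ∈ Ioo 0 Q, (if d ∣ b then (d : ℝ) / b else 0)
      ≤ ∑ _d ∈ Nat.divisors Q, (1 + Real.log Q) := sum_le_sum hharm
    _ = (Nat.divisors Q).card * (1 + Real.log Q) := by rw [sum_const, nsmul_eq_mul]

/-- `∑_{0<b<Q} (b,Q)/|e(b/Q) - 1| ≤ (Q/2) τ(Q) (1 + log Q)` (Jordan's inequality in the form of the
tree's `inv_norm_e_sub_one_le`, the reflection `b ↦ Q - b`, and `sum_gcd_div_le`). [folklore] -/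
theorem sum_gcd_mul_inv_norm_le (Q : ℕ) :
    ∑ b ∈ Ioo 0 Q, ((Nat.gcd b Q : ℕ) : ℝ) / ‖e ((b : ℝ) / Q) - 1‖ ≤
      (Q : ℝ) / 2 * ((Nat.divisors Q).card * (1 + Real.log Q)) := by
  have h1 : ∀ b ∈ Ioo 0 Q, ((Nat.gcd b Q : ℕ) : ℝ) / ‖e ((b : ℝ) / Q) - 1‖ ≤
      ((Nat.gcd b Q : ℕ) : ℝ) * ((Q : ℝ) / (4 * b) + (Q : ℝ) / (4 * (Q - b : ℕ))) := by
    intro b hb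
    rw [mem_Ioo] at hb
    rw [div_eq_mul_inv]
    exact mul_le_mul_of_nonneg_left (inv_norm_e_sub_one_le hb.1 hb.2) (Nat.cast_nonneg _)
  refine (sum_le_sum h1).trans ?_
  have hreflect : ∑ b ∈ Ioo 0 Q, ((Nat.gcd b Q : ℕ) : ℝ) * ((Q : ℝ) / (4 * (Q - b : ℕ))) =
      ∑ b ∈ Ioo 0 Q, ((Nat.gcd b Q : ℕ) : ℝ) * ((Q : ℝ) / (4 * b)) := by
    refine Finset.sum_nbij' (fun b => Q - b) (fun b => Q - b) ?_ ?_ ?_ ?_ ?_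
    · intro b hb; rw [mem_Ioo] at hb ⊢; omega
    · intro b hb; rw [mem_Ioo] at hb ⊢; omega
    · intro b hb; rw [mem_Ioo] at hb; omega
    · intro b hb; rw [mem_Ioo] at hb; omega
    · intro b hb
      rw [mem_Ioo] at hb
      rw [Nat.gcd_self_sub_left (le_of_lt hb.2)]
  have hsplit : ∑ b ∈ Ioo 0 Q, ((Nat.gcd b Q : ℕ) : ℝ) * ((Q : ℝ) / (4 * b) + (Q : ℝ) / (4 * (Q - b : ℕ))) =
      ∑ b ∈ Ioo 0 Q, ((Nat.gcd b Q : ℕ) : ℝ) * ((Q : ℝ) / (4 * b)) +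
        ∑ b ∈ Ioo 0 Q, ((Nat.gcd b Q : ℕ) : ℝ) * ((Q : ℝ) / (4 * (Q - b : ℕ))) := by
    rw [← sum_add_distrib]
    exact sum_congr rfl fun b _ => mul_add _ _ _
  rw [hsplit, hreflect, ← two_mul]
  have h2 : ∑ b ∈ Ioo 0 Q, ((Nat.gcd b Q : ℕ) : ℝ) * ((Q : ℝ) / (4 * b)) =
      (Q : ℝ) / 4 * ∑ b ∈ Ioo 0 Q, ((Nat.gcd b Q : ℕ) : ℝ) / b := by
    rw [mul_sum]
    refine sum_congr rfl fun b hb => ?_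
    rw [mem_Ioo] at hb
    have hb0 : (0 : ℝ) < b := by exact_mod_cast hb.1
    field_simp
  rw [h2]
  have h3 := sum_gcd_div_le Q
  have hQ : (0 : ℝ) ≤ Q := Nat.cast_nonneg Q
  calc 2 * ((Q : ℝ) / 4 * ∑ b ∈ Ioo 0 Q, ((Nat.gcd b Q : ℕ) : ℝ) / b)
      = (Q : ℝ) / 2 * ∑ b ∈ Ioo 0 Q, ((Nat.gcd b Q : ℕ) : ℝ) / b := by ring
    _ ≤ (Q : ℝ) / 2 * ((Nat.divisors Q).card * (1 + Real.log Q)) := by gcongr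

/-- The unweighted case: `∑_{0<b<Q} 1/|e(b/Q) - 1| ≤ (Q/2)(1 + log Q)`. [folklore] -/
theorem sum_inv_norm_le (Q : ℕ) :
    ∑ b ∈ Ioo 0 Q, ‖e ((b : ℝ) / Q) - 1‖⁻¹ ≤ (Q : ℝ) / 2 * (1 + Real.log Q) := by
  refine le_trans (sum_le_sum fun b hb => ?_) (sum_Ioo_div_add_div_le Q)
  rw [mem_Ioo] at hb
  exact inv_norm_e_sub_one_le hb.1 hb.2

/-- A sum over the non-zero residues is the sum over `0 < b < Q` of the representatives.
[folklore] -/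
theorem sum_univ_ne_zero_eq_sum_Ioo {Q : ℕ} [NeZero Q] (F : ℕ → ℝ) :
    ∑ u : ZMod Q, (if u = 0 then 0 else F u.val) = ∑ b ∈ Ioo 0 Q, F b := by
  rw [← Literature.NumberTheory.Sieve.LargeSieve.sum_range_eq_sum_zmod]
  rw [Finset.range_eq_Ico, ← Finset.Ioo_insert_left (Nat.pos_of_ne_zero (NeZero.ne Q)),
    sum_insert (by simp)]
  simp only [Nat.cast_zero, ↓reduceIte, zero_add]
  refine sum_congr rfl fun b hb => ?_
  rw [mem_Ioo] at hb
  have hne : ((b : ℕ) : ZMod Q) ≠ 0 := by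
    rw [Ne, ZMod.natCast_eq_zero_iff]
    exact Nat.not_dvd_of_pos_of_lt hb.1 hb.2
  rw [if_neg hne, ZMod.val_cast_of_lt hb.2]

/-- **The frequency sum of the `Y`-bound**:
`∑_{u₁,u₂ ∈ ℤ/Qℤ∖{0}} (u₁,u₂,Q)^{1/2}/(|e(u₁/Q)-1| |e(u₂/Q)-1|) ≤ (Q²/4) τ(Q)² (1 + log Q)²`
(using `(u₁,u₂,Q)^{1/2} ≤ (u₁,u₂,Q) ≤ (u₁,Q)` and the two one-variable sums above; the source
bounds this by `x^{O(ε)} q²`). [cite: TaoTeravainen2021, proof of Proposition 7.1 (bound for Y)] -/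
theorem sum_sqrt_gcd_div_le (Q : ℕ) [NeZero Q] :
    ∑ u : ZMod Q × ZMod Q, (if u.1 = 0 ∨ u.2 = 0 then 0 else
      Real.sqrt (Nat.gcd (Nat.gcd u.1.val u.2.val) Q) /
        (‖e ((u.1.val : ℝ) / Q) - 1‖ * ‖e ((u.2.val : ℝ) / Q) - 1‖)) ≤
      (Q : ℝ) ^ 2 / 4 * (Nat.divisors Q).card ^ 2 * (1 + Real.log Q) ^ 2 := by
  have hQ0 : 0 < Q := Nat.pos_of_ne_zero (NeZero.ne Q)
  -- termwise: `√(u₁,u₂,Q) ≤ (u₁,Q)`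
  have hterm : ∀ u : ZMod Q × ZMod Q, (if u.1 = 0 ∨ u.2 = 0 then 0 else
      Real.sqrt (Nat.gcd (Nat.gcd u.1.val u.2.val) Q) /
        (‖e ((u.1.val : ℝ) / Q) - 1‖ * ‖e ((u.2.val : ℝ) / Q) - 1‖)) ≤
      (if u.1 = 0 then 0 else ((Nat.gcd u.1.val Q : ℕ) : ℝ) / ‖e ((u.1.val : ℝ) / Q) - 1‖) *
        (if u.2 = 0 then 0 else ‖e ((u.2.val : ℝ) / Q) - 1‖⁻¹) := by
    intro u
    by_cases h : u.1 = 0 ∨ u.2 = 0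
    · rw [if_pos h]
      rcases h with h | h
      · rw [if_pos h, zero_mul]
      · rw [if_pos h, mul_zero]
    · rw [if_neg h]
      push Not at h
      rw [if_neg h.1, if_neg h.2, ← div_div, div_eq_mul_inv (Real.sqrt _ / _)]
      gcongr
      -- `√d ≤ d ≤ (u₁, Q)` for the positive integer `d = (u₁,u₂,Q) ∣ (u₁,Q)`
      have hd : Nat.gcd (Nat.gcd u.1.val u.2.val) Q ∣ Nat.gcd u.1.val Q :=
        Nat.gcd_dvd_gcd_of_dvd_left _ (Nat.gcd_dvd_left _ _)
      have hpos : 0 < Nat.gcd u.1.val Q := Nat.gcd_pos_of_pos_right _ hQ0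
      have hle : (Nat.gcd (Nat.gcd u.1.val u.2.val) Q : ℝ) ≤ Nat.gcd u.1.val Q := by
        exact_mod_cast Nat.le_of_dvd hpos hd
      have h1 : (1 : ℝ) ≤ Nat.gcd (Nat.gcd u.1.val u.2.val) Q := by
        exact_mod_cast Nat.gcd_pos_of_pos_right _ hQ0
      calc Real.sqrt (Nat.gcd (Nat.gcd u.1.val u.2.val) Q)
          ≤ (Nat.gcd (Nat.gcd u.1.val u.2.val) Q : ℝ) := by
            rw [Real.sqrt_le_left (by linarith)]
            nlinarith
        _ ≤ _ := hle
  refine (sum_le_sum fun u _ => hterm u).trans ?_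
  rw [Fintype.sum_prod_type]
  simp only
  rw [← Fintype.sum_mul_sum]
  -- the two one-variable sums
  have hA : ∑ u₁ : ZMod Q, (if u₁ = 0 then 0 else
      ((Nat.gcd u₁.val Q : ℕ) : ℝ) / ‖e ((u₁.val : ℝ) / Q) - 1‖) ≤
      (Q : ℝ) / 2 * ((Nat.divisors Q).card * (1 + Real.log Q)) := by
    rw [sum_univ_ne_zero_eq_sum_Ioo (fun b : ℕ => ((Nat.gcd b Q : ℕ) : ℝ) / ‖e ((b : ℝ) / Q) - 1‖)]
    exact sum_gcd_mul_inv_norm_le Q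
  have hB : ∑ u₂ : ZMod Q, (if u₂ = 0 then 0 else ‖e ((u₂.val : ℝ) / Q) - 1‖⁻¹) ≤
      (Q : ℝ) / 2 * (1 + Real.log Q) := by
    rw [sum_univ_ne_zero_eq_sum_Ioo (fun b : ℕ => ‖e ((b : ℝ) / Q) - 1‖⁻¹)]
    exact sum_inv_norm_le Q
  have hA0 : 0 ≤ ∑ u₁ : ZMod Q, (if u₁ = 0 then 0 else
      ((Nat.gcd u₁.val Q : ℕ) : ℝ) / ‖e ((u₁.val : ℝ) / Q) - 1‖) :=
    sum_nonneg fun u _ => by split_ifs <;> positivity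
  have hB0 : 0 ≤ ∑ u₂ : ZMod Q, (if u₂ = 0 then 0 else ‖e ((u₂.val : ℝ) / Q) - 1‖⁻¹) :=
    sum_nonneg fun u _ => by split_ifs <;> positivity
  have hlog : 0 ≤ 1 + Real.log Q := by
    have : 0 ≤ Real.log Q := Real.log_natCast_nonneg Q
    linarith
  calc (∑ u₁ : ZMod Q, (if u₁ = 0 then 0 else
        ((Nat.gcd u₁.val Q : ℕ) : ℝ) / ‖e ((u₁.val : ℝ) / Q) - 1‖)) *
        ∑ u₂ : ZMod Q, (if u₂ = 0 then 0 else ‖e ((u₂.val : ℝ) / Q) - 1‖⁻¹)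
      ≤ ((Q : ℝ) / 2 * ((Nat.divisors Q).card * (1 + Real.log Q))) *
          ((Q : ℝ) / 2 * (1 + Real.log Q)) :=
        mul_le_mul hA hB hB0 (by positivity)
    _ = (Q : ℝ) ^ 2 / 4 * (Nat.divisors Q).card * (1 + Real.log Q) ^ 2 := by ring
    _ ≤ (Q : ℝ) ^ 2 / 4 * (Nat.divisors Q).card ^ 2 * (1 + Real.log Q) ^ 2 := by
        have hτ : (1 : ℝ) ≤ (Nat.divisors Q).card := by
          exact_mod_cast Finset.card_pos.mpr ⟨1, Nat.one_mem_divisors.mpr (NeZero.ne Q)⟩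
        have hτ2 : ((Nat.divisors Q).card : ℝ) ≤ ((Nat.divisors Q).card : ℝ) ^ 2 := by nlinarith
        gcongr

end TaoTeravainen

end Literature.Barriers.Parity
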